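import Summits.BirchSwinnertonDyer.BirchSwinnertonDyer.Theorems.ThetaPartnerAtTwoSignedKatoUpToAtTwoKatoBKCoreKZLit
import HarnessLib

/-!
# Route `ThetaPartnerAtTwo` (TP2), crux K3 `SignedKatoDivisibilityUpToAtTwo` (stmt-BirchSwinnertonDyer-20308) / K3P′
# (stmt-BirchSwinnertonDyer-25631), line `colemanrat` v14.1 — the Λ-FREE residue in LITERATURE VOCABULARY (`CORE_KZ⁰_Lit ⟹ CORE_KZ⁰`)

Width seat `bsd-wall-tp2-p2x-w2` g8 (cell `bsd-wall`); the Λ-free twin of lead g8's `KatoBK.coreKZ_of_coreKZLit` (`…KatoBKCoreKZLit`,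
p640162), whose plumbing (`zCoord_ptCast_symm`, `map_integralModelInt_twoAdic`, `ptLogΩ_toLoc_symm_eq`) is imported, not restated.
CORE_KZ⁰_Lit := lead g8's CORE_KZ_Lit (Kato's zeta-value package at `2` in Literature + Mathlib names: pairing value through its residues
`CyclotomicLayer.tatePairingPk`, logarithm `Σᵢ logᵢ·z(Q₀)ⁱ` of `(W ⊗ ℚ₂).formalLog`, formal-group condition `1 < v x(Q₀)`, any COHERENT
`2`-adic frame `e` with lifts `τ`, standard complex embeddings) with «∃ ΛK, … ZetaBody W 2 f ιC κK ΛK c d a A z x ∧ (KZ_Lit)» REPLACED by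
«∃ z x, (C1) IsEulerSystem ∧ (C2) unramified away from 2 ∧ (C5) value law ∧ (KZ_Lit)» — the conjuncts VERBATIM from `Kato2004.ZetaBody`
(lets expanded), NO dual-exponential datum `Λ` and none of its clauses (C3a)/(C3b)/(C4) (idle in the line: audit in
`…KatoBKLambdaFree{Values,CharValues,ESClass}`, memo `Cruxes/SignedKatoDivisibilityUpToAtTwo/W2G8-LAMBDA-FREE.md`). Conclusion = CORE_KZ⁰,
the displayed hypothesis of `KatoBK.corePairChiPrim_of_coreKZ0_of_bricks` (`…KatoBKSocketKZ0`, p640031) VERBATIM; so a Literature fact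
filed with the Λ-free matrix closes K3P′ by `KatoBK.signedKatoDivisibilityUpToAtTwoOfPub_of_coreKZ0 ∘ coreKZ0_of_coreKZ0Lit` and K3 by
`…_of_contraFact_of_gzk_of_coreKZ0` (`…OfPubKZ0`, p640439). Proof = the lead's, with `hbody ↦ ⟨hC1, hC2, hC5⟩`. HONEST FRAMING: one
conditional theorem (hypothesis displayed); no definition, no named fact, no instance, no `sorry`; closes no item; K3/K3P′ NOT settled;
BSD is NOT proved by any of this.
-/

set_option autoImplicit false
-- the Theorems namespace of this sub repeats the summit name by design (D-0017 nested layout)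
set_option linter.dupNamespace false

noncomputable section

set_option backward.isDefEq.respectTransparency false

open scoped Classical MatrixGroups ModularForm NumberField TensorProduct

open CongruenceSubgroup WeierstrassCurve Field IsDedekindDomain NumberField
  Literature.NumberTheory.GaloisRepresentations
  Literature.NumberTheory.EllipticCurves Literature.NumberTheory.EllipticCurves.ModularForms
  Literature.NumberTheory.EllipticCurves.Module Literature.NumberTheory.EllipticCurves.Rank1Residual
  Literature.NumberTheory.EllipticCurves.Kobayashi2003 Literature.NumberTheory.EllipticCurves.Kato2004
  Literature.NumberTheory.EllipticCurves.Kato2004.EulerSystemValues Literature.NumberTheory.EllipticCurves.GreenbergSelmer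
  Literature.NumberTheory.EllipticCurves.Sprung2012
  Literature.NumberTheory.EllipticCurves.FormalGroupChart
  ZpExtension Summit.BirchSwinnertonDyer.Rank1Residual.Supersingular
  Summit.BirchSwinnertonDyer.Rank1Residual.Additive Summit.BirchSwinnertonDyer.Rank1Residual.Additive.PadicCyclotomicTower
  Summit.BirchSwinnertonDyer.Rank1Residual.Additive.BallEval
  Summit.BirchSwinnertonDyer.BirchSwinnertonDyer.Theorems.SignedKatoOffTwo.LocalTwo

open Rat.HeightOneSpectrum (primesEquiv)

namespace Summit.BirchSwinnertonDyer.BirchSwinnertonDyer.Theorems.SignedKatoOffTwo.KatoBK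

/-! ## CORE_KZ⁰_Lit ⟹ CORE_KZ⁰ -/

/-- **The Λ-free residue in Literature vocabulary implies the Λ-free residue of the socket.** Hypothesis `hlit` = CORE_KZ⁰_Lit (lead g8's
CORE_KZ_Lit with Kato's abstract dual-exponential datum and its clauses (C3a)(C3b)(C4) removed: (C1) Euler system [Kato Ex. 13.3, Prop. 8.12,
(13.1.1)], (C2) unramified away from `2` [(8.1.3), §8.2, Lemma 8.5], (C5) value law [Thm. 9.7 ∘ Thm. 6.6 (1)], (KZ_Lit) layer Tate pairing of
`Cor z_{2^{n+2}}` with formal points = `Tr(log_ω Q · x_{n+2})` [Thm. 12.5 (1) via BK90 (3.10.1)/(3.11)]); conclusion = CORE_KZ⁰ verbatim.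
Proof: the lead's `coreKZ_of_coreKZLit` with `hbody ↦ ⟨hC1, hC2, hC5⟩` (frame coherence from `zeta_succ_pow`, kernel condition along `toLoc`,
`pair n x Q` from its residues by (P3), `ptLogΩ_toLoc_symm_eq`).
[cite: Kato2004Asterisque, Thm. 12.5 (1) (p. 222), Ex. 13.3 (p. 225), Thm. 9.7 (p. 189), Thm. 6.6 (1) (p. 163)] [cite: BlochKato1990, §3 (3.10.1), (3.11)]
[cite: Kobayashi2003, (8.23), Prop. 8.25 (p. 18)] -/
theorem coreKZ0_of_coreKZ0Lit
    (hlit :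
      ∀ (v : HeightOneSpectrum (𝓞 ℚ)), ((2 : ℕ) : 𝓞 ℚ) ∈ v.asIdeal →
      ∀ (W : WeierstrassCurve ℚ) [W.IsElliptic] [W.IsGloballyMinimal], GoodSS W 2 →
        ∀ (κ : ZpExtension ℚ 2) (hκ : κ.IsCyclotomic),
          ∀ [NeZero (W.conductorNorm ℤ)] (f : CuspForm (Gamma0 (W.conductorNorm ℤ)) 2), IsNewformOf W f →
          ∀ [ContinuousSMul ℤ_[2] (W.tateModule 2)] [Module.Free ℤ_[2] (W.tateModule 2)]
            [Module.Finite ℤ_[2] (W.tateModule 2)],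
          ∀ (Φ : AlgebraicClosure ℚ_[2] ≃ₐ[ℚ] AlgebraicClosure (v.adicCompletion ℚ)) (φ : ℚ_[2] ≃+* v.adicCompletion ℚ),
            (∀ y : ℚ_[2], Φ (algebraMap ℚ_[2] (AlgebraicClosure ℚ_[2]) y) =
              algebraMap (v.adicCompletion ℚ) (AlgebraicClosure (v.adicCompletion ℚ)) (φ y)) →
          ∀ (e : ∀ k : ℕ, CyclotomicField (cycLevel 2 k ∅) ℚ →ₐ[ℚ] PadicAlgCl 2)
            (τ : ∀ m : ℕ, ZMod (2 ^ m) → Field.absoluteGaloisGroup ℚ_[2]),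
            -- the `2`-adic frame: a COHERENT tower `e_{k+1}(ζ_{2^{k+1}})² = e_k(ζ_{2^k})` with Galois lifts `τ_a : e_k(ζ) ↦ e_k(ζ)^a`
            (∀ k : ℕ, e (k + 1) (IsCyclotomicExtension.zeta (cycLevel 2 (k + 1) ∅) ℚ (CyclotomicField (cycLevel 2 (k + 1) ∅) ℚ)) ^ 2 =
              e k (IsCyclotomicExtension.zeta (cycLevel 2 k ∅) ℚ (CyclotomicField (cycLevel 2 k ∅) ℚ))) →
            (∀ (k : ℕ) (a : ZMod (2 ^ k)), IsUnit a →
              τ k a • e k (IsCyclotomicExtension.zeta (cycLevel 2 k ∅) ℚ (CyclotomicField (cycLevel 2 k ∅) ℚ)) =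
                e k (IsCyclotomicExtension.zeta (cycLevel 2 k ∅) ℚ (CyclotomicField (cycLevel 2 k ∅) ℚ)) ^ a.val) →
          -- the complex frame: the STANDARD embeddings at the pure levels (Kato (5.7.1))
          ∀ (ιC : (m : ℕ) → (CyclotomicField m ℚ →+* ℂ)),
          (∀ k : ℕ, ιC (cycLevel 2 k ∅) (IsCyclotomicExtension.zeta (cycLevel 2 k ∅) ℚ (CyclotomicField (cycLevel 2 k ∅) ℚ)) =
            Complex.exp (2 * Real.pi * Complex.I / (cycLevel 2 k ∅ : ℕ))) →
          ∃ κK : ℝ, κK ≠ 0 ∧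
            ∀ (c d a : ℤ) (A : ℕ), 0 < A → Int.gcd c (6 * 2 * A) = 1 → Int.gcd d (6 * 2 * W.conductorNorm ℤ) = 1 →
              ∃ (z : ∀ (k : ℕ) (r : (cyclotomicLevelsRat 2 (badPlaces c d A (W.conductorNorm ℤ))).Ideals),
                    H1 (tateRep W 2) ((cyclotomicLevelsRat 2 (badPlaces c d A (W.conductorNorm ℤ))).level k r.1))
                (x : ∀ (k : ℕ) (r : (cyclotomicLevelsRat 2 (badPlaces c d A (W.conductorNorm ℤ))).Ideals),
                    CyclotomicField (cycLevel 2 k r.1) ℚ),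
                IsEulerSystem (cyclotomicLevelsRat 2 (badPlaces c d A (W.conductorNorm ℤ))) (tateRep W 2) 2 z ∧
                (∀ (k : ℕ) (r : (cyclotomicLevelsRat 2 (badPlaces c d A (W.conductorNorm ℤ))).Ideals) (v : HeightOneSpectrum (𝓞 ℚ)),
                  ((primesEquiv v : Nat.Primes) : ℕ) ≠ 2 →
                  ∀ 𝔓 ∈ v.primesAbove,
                    resLe (tateRep W 2).toTopRep
                        (inf_le_left : (cyclotomicLevelsRat 2 (badPlaces c d A (W.conductorNorm ℤ))).level k r.1 ⊓ 𝔓.inertia (absoluteGaloisGroup ℚ) ≤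
                          (cyclotomicLevelsRat 2 (badPlaces c d A (W.conductorNorm ℤ))).level k r.1)
                        1 (z k r) = 0) ∧
                (∀ (k : ℕ) (r : (cyclotomicLevelsRat 2 (badPlaces c d A (W.conductorNorm ℤ))).Ideals) (d' : ℤ)
                    (χ : DirichletCharacter ℂ (cycLevel 2 k r.1)) (Lχ : ℂ → ℂ),
                  Int.gcd (c * d) (cycLevel 2 k r.1 * A) = 1 →
                  d * d' ≡ 1 [ZMOD (A : ℤ)] →
                  IsDepletedTwistedL f (cycLevel 2 k r.1) (2 * A) χ Lχ →
                    (χ (-1) = 1 →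
                      charSum (cycLevel 2 k r.1) (ιC (cycLevel 2 k r.1)) χ (x k r) =
                        (κK : ℂ) * (Lχ 1 / (plusPeriod f : ℂ)) *
                          cuspFactor f true (fun n ↦ χ⁻¹ (n : ZMod (cycLevel 2 k r.1))) c d a A d') ∧
                    (χ (-1) = -1 →
                      charSum (cycLevel 2 k r.1) (ιC (cycLevel 2 k r.1)) χ (x k r) =
                        -(κK : ℂ) * (Lχ 1 / (Complex.I * (minusPeriod f : ℂ))) *
                          cuspFactor f false (fun n ↦ χ⁻¹ (n : ZMod (cycLevel 2 k r.1))) c d a A d')) ∧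
                ∀ (n : ℕ) (Q₀ : localPoints W ℚ_[2])
                  (hQv : WeierstrassCurve.Affine.Point.map (W' := W)
                      (Φ : AlgebraicClosure ℚ_[2] →ₐ[ℚ] AlgebraicClosure (v.adicCompletion ℚ))
                      (show (W.baseChange (AlgebraicClosure ℚ_[2])).toAffine.Point from Q₀) ∈
                    localLayerPointsOfEmb κ (closureEmb (K := ℚ) (v.adicCompletion ℚ)) W n),
                  (∀ (X Y : AlgebraicClosure ℚ_[2]) (hXY : (W.baseChange (AlgebraicClosure ℚ_[2])).toAffine.Nonsingular X Y),
                      (show (W.baseChange (AlgebraicClosure ℚ_[2])).toAffine.Point from Q₀) = .some X Y hXY → 1 < Valued.v X) →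
                  ∃ t : ℤ_[2],
                    (∀ k : ℕ, CyclotomicLayer.tatePairingPk W κ v n k
                        (levelToLayerTwo W hκ (∅ : Set (HeightOneSpectrum (𝓞 ℚ))) n
                          (z (n + 2) (cyclotomicLevelsRat 2 (badPlaces c d A (W.conductorNorm ℤ))).idealOne))
                        ⟨_, hQv⟩ = PadicInt.toZModPow k t) ∧
                    algebraMap ℚ_[2] (PadicAlgCl 2) (t : ℚ_[2]) =
                      ∑ b : (ZMod (2 ^ (n + 2)))ˣ, τ (n + 2) (b : ZMod (2 ^ (n + 2))) •
                        ((∑' i : ℕ, algebraMap ℚ_[2] (PadicAlgCl 2) (PowerSeries.coeff i (W.map (algebraMap ℚ ℚ_[2])).formalLog) *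
                            (WeierstrassCurve.Affine.Point.zCoord
                              (show (W.baseChange (AlgebraicClosure ℚ_[2])).toAffine.Point from Q₀)) ^ i) *
                          e (n + 2) (x (n + 2) (cyclotomicLevelsRat 2 (badPlaces c d A (W.conductorNorm ℤ))).idealOne))) :
      ∀ (v : HeightOneSpectrum (𝓞 ℚ)), ((2 : ℕ) : 𝓞 ℚ) ∈ v.asIdeal →
      ∀ (W : WeierstrassCurve ℚ) [W.IsElliptic] [W.IsGloballyMinimal],
        ¬ W.HasCM → W.analyticRank = 0 → GoodSS W 2 → W.frobeniusTrace 2 = 0 →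
        ∀ (κ : ZpExtension ℚ 2) (γ : Field.absoluteGaloisGroup ℚ) (hκ : κ.IsCyclotomic),
          κ.IsTopGenerator γ → IsCyclotomicVariable 2 γ →
          ∀ [NeZero (W.conductorNorm ℤ)] (f : CuspForm (Gamma0 (W.conductorNorm ℤ)) 2),
            IsNewformOf W f → ∀ (ϖ : ℚ), (ϖ : ℝ) * W.realPeriodRat = plusPeriod f →
          ∀ (Lplus Lminus : IwasawaAlgebra 2), IsPollackPair f 2 Lplus Lminus →
          ∀ [ContinuousSMul ℤ_[2] (W.tateModule 2)] [Module.Free ℤ_[2] (W.tateModule 2)]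
            [Module.Finite ℤ_[2] (W.tateModule 2)],
          ∀ (pair : ∀ n : ℕ, H1 (tateRep W 2) (κ.layerSubgroup n) →ₗ[ℤ_[2]]
              (localLayerPointsOfEmb κ (closureEmb (K := ℚ) (v.adicCompletion ℚ)) W n →+ ℤ_[2])),
            (∀ (n : ℕ) (x : H1 (tateRep W 2) (κ.layerSubgroup (n + 1))) (Q : localPoints W (v.adicCompletion ℚ))
              (hQ : Q ∈ localLayerPointsOfEmb κ (closureEmb (K := ℚ) (v.adicCompletion ℚ)) W n),
              pair n (layerCores (tateRep W 2) κ n x) ⟨Q, hQ⟩ =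
                pair (n + 1) x ⟨Q, localLayerPointsOfEmb_mono κ (closureEmb (K := ℚ) (v.adicCompletion ℚ)) W (Nat.le_succ n) hQ⟩) →
            (∀ (n : ℕ) (g : absoluteGaloisGroup (v.adicCompletion ℚ)) (y : H1 (tateRep W 2) (κ.layerSubgroup n))
              (Q : localPoints W (v.adicCompletion ℚ))
              (hQ : Q ∈ localLayerPointsOfEmb κ (closureEmb (K := ℚ) (v.adicCompletion ℚ)) W n),
              pair n (conjMap (tateRep W 2).toTopRep (κ.layerSubgroup n) (resGalOfEmb (closureEmb (K := ℚ) (v.adicCompletion ℚ)) g) 1 y)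
                ⟨g • Q, smul_mem_localLayerPointsOfEmb κ (closureEmb (K := ℚ) (v.adicCompletion ℚ)) W n g hQ⟩ = pair n y ⟨Q, hQ⟩) →
            (∀ (n k : ℕ) (x : H1 (tateRep W 2) (κ.layerSubgroup n))
              (Q : localLayerPointsOfEmb κ (closureEmb (K := ℚ) (v.adicCompletion ℚ)) W n),
              PadicInt.toZModPow k (pair n x Q) =
                LayerPairing.layerPairingPk W κ v (LayerPairing.weilTowerPk W) (LayerPairing.weilTowerPk_pow W)
                  (LayerPairing.weilTowerPk_add_left W) (LayerPairing.weilTowerPk_add_right W) (LayerPairing.weilTowerPk_smul W)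
                  n k x Q) →
          ∀ (Φ : AlgebraicClosure ℚ_[2] ≃ₐ[ℚ] AlgebraicClosure (v.adicCompletion ℚ)) (φ : ℚ_[2] ≃+* v.adicCompletion ℚ),
            (∀ y : ℚ_[2], Φ (algebraMap ℚ_[2] (AlgebraicClosure ℚ_[2]) y) =
              algebraMap (v.adicCompletion ℚ) (AlgebraicClosure (v.adicCompletion ℚ)) (φ y)) →
          ∀ (ι : AlgebraicClosure ℚ →ₐ[ℚ] AlgebraicClosure ℚ_[2]),
            (∀ z, closureEmb (K := ℚ) (v.adicCompletion ℚ) z = Φ (ι z)) →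
          ∀ (e : ∀ k : ℕ, CyclotomicField (cycLevel 2 k ∅) ℚ →ₐ[ℚ] PadicAlgCl 2),
            (∀ k, e k (IsCyclotomicExtension.zeta (cycLevel 2 k ∅) ℚ (CyclotomicField (cycLevel 2 k ∅) ℚ)) = zeta 2 k) →
          ∀ (τ : ∀ m : ℕ, ZMod (2 ^ m) → Field.absoluteGaloisGroup ℚ_[2]),
            (∀ (m : ℕ) (a : ZMod (2 ^ m)), IsUnit a → τ m a • zeta 2 m = zeta 2 m ^ a.val) →
          ∀ (ιC : (m : ℕ) → (CyclotomicField m ℚ →+* ℂ)),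
          (∀ k : ℕ, ιC (cycLevel 2 k ∅) (IsCyclotomicExtension.zeta (cycLevel 2 k ∅) ℚ (CyclotomicField (cycLevel 2 k ∅) ℚ)) =
            Complex.exp (2 * Real.pi * Complex.I / (cycLevel 2 k ∅ : ℕ))) →
          ∃ κK : ℝ, κK ≠ 0 ∧
            ∀ (c d a : ℤ) (A : ℕ), 0 < A → Int.gcd c (6 * 2 * A) = 1 → Int.gcd d (6 * 2 * W.conductorNorm ℤ) = 1 →
              ∃ (z : ∀ (k : ℕ) (r : (cyclotomicLevelsRat 2 (badPlaces c d A (W.conductorNorm ℤ))).Ideals),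
                    H1 (tateRep W 2) ((cyclotomicLevelsRat 2 (badPlaces c d A (W.conductorNorm ℤ))).level k r.1))
                (x : ∀ (k : ℕ) (r : (cyclotomicLevelsRat 2 (badPlaces c d A (W.conductorNorm ℤ))).Ideals),
                    CyclotomicField (cycLevel 2 k r.1) ℚ),
                IsEulerSystem (cyclotomicLevelsRat 2 (badPlaces c d A (W.conductorNorm ℤ))) (tateRep W 2) 2 z ∧
                (∀ (k : ℕ) (r : (cyclotomicLevelsRat 2 (badPlaces c d A (W.conductorNorm ℤ))).Ideals) (v : HeightOneSpectrum (𝓞 ℚ)),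
                  ((primesEquiv v : Nat.Primes) : ℕ) ≠ 2 →
                  ∀ 𝔓 ∈ v.primesAbove,
                    resLe (tateRep W 2).toTopRep
                        (inf_le_left : (cyclotomicLevelsRat 2 (badPlaces c d A (W.conductorNorm ℤ))).level k r.1 ⊓ 𝔓.inertia (absoluteGaloisGroup ℚ) ≤
                          (cyclotomicLevelsRat 2 (badPlaces c d A (W.conductorNorm ℤ))).level k r.1)
                        1 (z k r) = 0) ∧
                (∀ (k : ℕ) (r : (cyclotomicLevelsRat 2 (badPlaces c d A (W.conductorNorm ℤ))).Ideals) (d' : ℤ)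
                    (χ : DirichletCharacter ℂ (cycLevel 2 k r.1)) (Lχ : ℂ → ℂ),
                  Int.gcd (c * d) (cycLevel 2 k r.1 * A) = 1 →
                  d * d' ≡ 1 [ZMOD (A : ℤ)] →
                  IsDepletedTwistedL f (cycLevel 2 k r.1) (2 * A) χ Lχ →
                    (χ (-1) = 1 →
                      charSum (cycLevel 2 k r.1) (ιC (cycLevel 2 k r.1)) χ (x k r) =
                        (κK : ℂ) * (Lχ 1 / (plusPeriod f : ℂ)) *
                          cuspFactor f true (fun n ↦ χ⁻¹ (n : ZMod (cycLevel 2 k r.1))) c d a A d') ∧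
                    (χ (-1) = -1 →
                      charSum (cycLevel 2 k r.1) (ιC (cycLevel 2 k r.1)) χ (x k r) =
                        -(κK : ℂ) * (Lχ 1 / (Complex.I * (minusPeriod f : ℂ))) *
                          cuspFactor f false (fun n ↦ χ⁻¹ (n : ZMod (cycLevel 2 k r.1))) c d a A d')) ∧
                (haveI := isIntegral_genFib_baseChange 2 ((integralModelInt W).map (Int.castRingHom ℤ_[2]))
                 ∀ (n : ℕ) (Q₀ : localPoints W ℚ_[2])
                  (hQv : WeierstrassCurve.Affine.Point.map (W' := W)
                      (Φ : AlgebraicClosure ℚ_[2] →ₐ[ℚ] AlgebraicClosure (v.adicCompletion ℚ))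
                      (show (W.baseChange (AlgebraicClosure ℚ_[2])).toAffine.Point from Q₀) ∈
                    localLayerPointsOfEmb κ (closureEmb (K := ℚ) (v.adicCompletion ℚ)) W n),
                  (toLoc ((genFibΩ_eq_baseChange ((integralModelInt W).map (Int.castRingHom ℤ_[2]))).trans
                    (baseChange_twoAdicModel W))).symm Q₀ ∈
                    kernel (Valued.v (R := PadicAlgCl 2)) (genFibΩ 2 ((integralModelInt W).map (Int.castRingHom ℤ_[2]))) →
                  algebraMap ℚ_[2] (PadicAlgCl 2)
                      ((pair n (levelToLayerTwo W hκ (∅ : Set (HeightOneSpectrum (𝓞 ℚ))) n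
                          (z (n + 2) (cyclotomicLevelsRat 2 (badPlaces c d A (W.conductorNorm ℤ))).idealOne))
                        ⟨_, hQv⟩ : ℤ_[2]) : ℚ_[2]) =
                    ∑ b : (ZMod (2 ^ (n + 2)))ˣ, τ (n + 2) (b : ZMod (2 ^ (n + 2))) •
                      (ptLogΩ 2 ((integralModelInt W).map (Int.castRingHom ℤ_[2]))
                          ((toLoc ((genFibΩ_eq_baseChange ((integralModelInt W).map (Int.castRingHom ℤ_[2]))).trans
                            (baseChange_twoAdicModel W))).symm Q₀) *
                        e (n + 2) (x (n + 2) (cyclotomicLevelsRat 2 (badPlaces c d A (W.conductorNorm ℤ))).idealOne))) := by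
  intro v hv W _ _ hcm hr hss ha κ γ hκ hγ hvar _ f hf ϖ hϖ Lplus Lminus hPol _ _ _ pair hP1 hP2 hP3 Φ φ hΦφ ι hι e he τ hτ ιC hιC
  -- the `e`/`τ` compatibility of CORE_KZ_Lit from the pinned tower `zeta 2`
  have heτ : ∀ (k : ℕ) (a : ZMod (2 ^ k)), IsUnit a →
      τ k a • e k (IsCyclotomicExtension.zeta (cycLevel 2 k ∅) ℚ (CyclotomicField (cycLevel 2 k ∅) ℚ)) =
        e k (IsCyclotomicExtension.zeta (cycLevel 2 k ∅) ℚ (CyclotomicField (cycLevel 2 k ∅) ℚ)) ^ a.val := by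
    intro k a ha; rw [he k]; exact hτ k a ha
  have hcoh : ∀ k : ℕ, e (k + 1) (IsCyclotomicExtension.zeta (cycLevel 2 (k + 1) ∅) ℚ (CyclotomicField (cycLevel 2 (k + 1) ∅) ℚ)) ^ 2 =
      e k (IsCyclotomicExtension.zeta (cycLevel 2 k ∅) ℚ (CyclotomicField (cycLevel 2 k ∅) ℚ)) := by
    intro k; rw [he, he]; exact zeta_succ_pow 2 k
  obtain ⟨κK, hκK, hmain⟩ := hlit v hv W hss κ hκ f hf Φ φ hΦφ e τ hcoh heτ ιC hιC
  refine ⟨κK, hκK, fun c d a A hA hc hd ↦ ?_⟩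
  obtain ⟨z, x, hC1, hC2, hC5, hKZ⟩ := hmain c d a A hA hc hd
  refine ⟨z, x, hC1, hC2, hC5, ?_⟩
  intro n Q₀ hQv hker
  haveI := isIntegral_genFib_baseChange 2 ((integralModelInt W).map (Int.castRingHom ℤ_[2]))
  -- the formal-group condition, transported along `toLoc`
  have hker' := (toLoc_symm_mem_kernel_iff (W := W)
    ((genFibΩ_eq_baseChange ((integralModelInt W).map (Int.castRingHom ℤ_[2]))).trans (baseChange_twoAdicModel W)) Q₀).mp hker
  obtain ⟨t, ht, htval⟩ := hKZ n Q₀ hQv hker'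
  -- `pair n x Q = t` from the residues (P3)
  have hpair : pair n (levelToLayerTwo W hκ (∅ : Set (HeightOneSpectrum (𝓞 ℚ))) n
      (z (n + 2) (cyclotomicLevelsRat 2 (badPlaces c d A (W.conductorNorm ℤ))).idealOne)) ⟨_, hQv⟩ = t := by
    refine PadicInt.ext_of_toZModPow.mp fun k ↦ ?_
    rw [hP3, ← ht k]
    rfl
  rw [hpair, htval, ptLogΩ_toLoc_symm_eq]

end Summit.BirchSwinnertonDyer.BirchSwinnertonDyer.Theorems.SignedKatoOffTwo.KatoBK

end
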